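import Literature.NumberTheory.Irrationality.KrattenthalerRivoal2007.DenominatorsTheorem
import Literature.NumberTheory.Irrationality.Zudilin2003.ZetaFourRecursion
import HarnessLib

/-!
# Krattenthaler–Rivoal 2007, §11 Lemme 8 and §14 (Théorème 3 (i)): `Φ_n` divides the `ζ(4)` leading
# coefficients — the binomial double sum of Krattenthaler–Rivoal / Zudilin (2004)

Topic `Literature/NumberTheory/Irrationality/KrattenthalerRivoal2007` (companion of `DenominatorsTheorem.lean`,
whose `PhiKR n = Φ_n = ∏_{p prime, {n/p} ∈ [2/3,1)} p` and `fracGeTwoThirds` are reused). Sources, READ ON THE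
PAGE:

* C. Krattenthaler, T. Rivoal, *Hypergéométrie et fonction zêta de Riemann*, Mem. Amer. Math. Soc. **186**
  (2007) = arXiv:math/0311114 [KrattenthalerRivoal2007] (held text `paper:arxiv-math_0311114`): §2.4 p0007
  (Zudilin's series `S_{n,4,2,1,1}(1) = u_n ζ(4) − v_n`, the second-order recurrence
  `(n+1)⁵Y_{n+1} = 3(2n+1)(3n²+3n+1)(15n²+15n+4)Y_n + 3n³(3n−1)(3n+1)Y_{n−1}` «aussi obtenue par Cohen et Rhin …
  et par Sorokin», `Φ_n` (eq:Phi) and **Conjecture 2** «Pour tout entier n ≥ 0, les nombres Φ_n⁻¹u_n et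
  Φ_n⁻¹d_n⁴v_n sont entiers»); §3 p0008 **Théorème 3 (i)** «La Conjecture 2 est vraie pour le coefficient u_n,
  c'est-à-dire que Φ_n⁻¹u_n est un nombre entier»; §11 p0024 **Lemme 8** «Pour tout entier n > 0 et tout entier
  j, 0 ≤ j ≤ n, le nombre Φ_n divise C(n+j,n)·C(2n−j,n)» with its proof (`U = [N+J] + [2N−J] − [N−J] ≥ 1` when
  `N = {n/p} ≥ 2/3`); §14 p0032: «u_n = (−1)^{n+1} Σ_{0≤i≤j≤n} C(n,j)²C(n,i)²C(n+j,n)C(n+j−i,n)C(2n−i,n)» (from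
  their Proposition (cor:A4) with `A = 4, B = 2`), **Lemme 15** «Il existe des entiers C_{j,n} tels que
  u_n = Σ_j C(n+j,n)C(2n−j,n)C_{j,n}», proved by the identity
  `C(n,j)C(n+j−i,n)C(2n−i,n) = C(2n−j,n)C(2n−i,j−i)C(n+j−i,j)` with
  `C_{j,n} = (−1)^{n+1}C(n,j)Σ_i C(n,i)²C(2n−i,j−i)C(n+j−i,j)`, and «Quand on applique le Lemme 8 aux facteurs
  C(n+j,n)C(2n−j,n) … Φ_n divise u_n, ce qui est exactement l'énoncé de la partie i) du Théorème 3».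
* W. Zudilin, *Binomial sums related to rational approximations to ζ(4)*, Mat. Zametki **75** (2004) 637–640 =
  Math. Notes **75** (2004) 594–597 = arXiv:math/0311196 [Zudilin2004BinomialSums] (held text
  `paper:arxiv-math_0311196` p0001–p0002): for the solution `u_n` of the recurrence above with `u₀ = 1, u₁ = 12`
  (tree: `Zudilin2003.ZetaFour.u`, [Zudilin2003WellPoised, §2 (3)–(5)]) «C. Krattenthaler and T. Rivoal prove …
  that u_n = Σ_{i,j} C(n,i)²C(n,j)²C(n+j,n)C(n+j−i,n)C(2n−i,n), n = 0,1,2,…, from which one has the desired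
  inclusions u_n ∈ ℤ» (conjectured in [Zudilin2003WellPoised, §2]); the note re-proves it — eq. (5) — from
  Andrews's multisum generalisation of Whipple's transformation of a terminating very-well-poised `₇F₆(1)`
  (`q → 1` in [A, Thm 4]) by an `ε → 0` argument, and lists five more double-sum representations (a)–(e).

## What is here

* `zetaFourDoubleSum n = Σ_{0≤i≤j≤n} C(n,i)²C(n,j)²C(n+j,n)C(n+j−i,n)C(2n−i,n)` (a natural number; values
  `1, 12, 804, 88680` = the tree's `ZetaFour.u 0…3`, kernel-checked: `u_eq_zetaFourDoubleSum_le_three`).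
* PROVED — KR07 **Lemme 8** (`prime_dvd_choose_add_of_le_mod_add_mod`: a carry out of the lowest base-`p` digit
  of `n + j` forces `p ∣ C(n+j,n)`, by Lucas's theorem `Choose.choose_modEq_choose_mod_mul_choose_div_nat`;
  `prime_dvd_choose_mul_choose`: if `{n/p} ≥ 2/3` and `j + m = n`, one of the two additions `n + j`, `n + m`
  carries out of the lowest digit — the printed `U ≥ 1`; `lemme8`: `Φ_n ∣ C(n+j,n)C(2n−j,n)` for `j ≤ n`, `Φ_n`
  being a product of distinct primes), and its power form `PhiKR_pow_card_dvd_prod` used for general `B` in §14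
  (proof of Théorème 4 = (prop7gene): «On applique donc le Lemme 8 … pour conclure»).
* PROVED — KR07 **Lemme 15**: the binomial identity (`lemme15_identity`) and the regrouping
  `zetaFourDoubleSum n = Σ_j C(n+j,n)C(2n−j,n)·C_{j,n}` with the NATURAL numbers
  `lemme15Coeff n j = C(n,j)Σ_{i≤j} C(n,i)²C(2n−i,j−i)C(n+j−i,j)` (`zetaFourDoubleSum_eq_sum_lemme15`; the sign
  `(−1)^{n+1}` of the source belongs to its normalisation `u_n = (−1)^{n+1}·(double sum)` and is dropped).
* PROVED — **`PhiKR_dvd_zetaFourDoubleSum`: `Φ_n` divides the double sum** (Lemme 15 + Lemme 8), i.e. Théorème 3 (i)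
  for the binomial form of `u_n`.
* NAMED FACT (statement only) `u_eq_zetaFourDoubleSum`: the tree's recurrence-defined `ZetaFour.u n` equals the
  double sum [Zudilin2004BinomialSums (5); KrattenthalerRivoal2007 §14, Proposition (cor:A4) at `A = 4, B = 2`].
  Its printed proofs go through Andrews's multisum Whipple transformation (absent from the tree); a discharge
  by creative telescoping (show that `zetaFourDoubleSum` solves `ZetaFour.IsSolution` and use `u₀ = 1, u₁ = 12`)
  is the natural route for a certificate-equipped seat. Under it: **Théorème 3 (i)** `Φ_n⁻¹u_n ∈ ℤ`
  (`theoreme3_i`) and `u_n ∈ ℤ` (`u_isInt_of`), both PROVED from the fact.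

HONEST FRAMING (cell zeta5-irr): a `ζ(4)` record (the forms `u_nζ(4) − v_n` do not even prove `ζ(4) ∉ ℚ`,
[Zudilin2003WellPoised, §2]); nothing here concerns `ζ(5)`; it is the first kernel instance of the `Φ_n`-saving
mechanism of [KrattenthalerRivoal2007, Théorèmes 3–5] (the tree's named facts `theoreme4`, `theoreme5`).
Net new unproved facts: 1 (`u_eq_zetaFourDoubleSum`).
-/

open Finset
open scoped Nat

namespace Literature.NumberTheory.Irrationality.KrattenthalerRivoal2007

/-! ### §11 Lemme 8: `Φ_n ∣ C(n+j,n)·C(2n−j,n)` -/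

/-- A carry out of the lowest base-`p` digit in the addition `n + j` (i.e. `n mod p + j mod p ≥ p`) forces
`p ∣ C(n+j, n)`: by Lucas's theorem `C(n+j,n) ≡ C((n+j) mod p, n mod p)·C(⌊(n+j)/p⌋, ⌊n/p⌋)` and the first factor
vanishes since `(n+j) mod p = n mod p + j mod p − p < n mod p`. (The printed proof counts
`v_p ≥ [N+J] ≥ 1` with `N = {n/p}`, `J = {j/p}`.) [cite: KrattenthalerRivoal2007, §11 Lemme 8 (proof)] -/
theorem prime_dvd_choose_add_of_le_mod_add_mod {p n j : ℕ} (hp : p.Prime) (h : p ≤ n % p + j % p) :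
    p ∣ (n + j).choose n := by
  haveI := Fact.mk hp
  have hp0 : 0 < p := hp.pos
  have hjn := Nat.mod_lt j hp0
  have hnn := Nat.mod_lt n hp0
  have hs : (n + j) % p = n % p + j % p - p := by
    rw [Nat.add_mod, Nat.mod_eq_sub_mod h, Nat.mod_eq_of_lt (by omega)]
  have hlt : (n + j) % p < n % p := by omega
  have hL := Choose.choose_modEq_choose_mod_mul_choose_div_nat (n := n + j) (k := n) (p := p)
  rw [Nat.choose_eq_zero_of_lt hlt, zero_mul] at hL
  exact Nat.modEq_zero_iff_dvd.1 hL

/-- The digit lemma behind Lemme 8, in symmetric form: if `{n/p} ∈ [2/3, 1)` (`fracGeTwoThirds n p`,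
`2p ≤ 3(n mod p)`) and `j + m = n`, then `p ∣ C(n+j,n)·C(n+m,n)` — one of the two additions `n + j`, `n + m`
carries out of the lowest digit, for otherwise `j mod p + m mod p < 2(p − n mod p) ≤ n mod p` contradicts
`j + m = n` (the printed «pour que U = 0, il faut … N < 2/3 : contradiction»).
[cite: KrattenthalerRivoal2007, §11 Lemme 8 (proof)] -/
theorem prime_dvd_choose_mul_choose {p n j m : ℕ} (hp : p.Prime) (h23 : fracGeTwoThirds n p)
    (hjm : j + m = n) : p ∣ (n + j).choose n * (n + m).choose n := by
  have hp0 : 0 < p := hp.pos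
  unfold fracGeTwoThirds at h23
  by_cases h1 : p ≤ n % p + j % p
  · exact dvd_mul_of_dvd_left (prime_dvd_choose_add_of_le_mod_add_mod hp h1) _
  by_cases h2 : p ≤ n % p + m % p
  · exact dvd_mul_of_dvd_right (prime_dvd_choose_add_of_le_mod_add_mod hp h2) _
  exfalso
  have hsum : (j + m) % p = (j % p + m % p) % p := Nat.add_mod _ _ _
  rw [hjm] at hsum
  have hs := Nat.mod_lt n hp0
  have hlt : j % p + m % p < n % p := by omega
  rw [Nat.mod_eq_of_lt (by omega : j % p + m % p < p)] at hsum
  omega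

/-- **Lemme 8** (Krattenthaler–Rivoal): for `0 ≤ j ≤ n`, `Φ_n = ∏_{p prime, {n/p} ∈ [2/3,1)} p` divides
`C(n+j, n)·C(2n−j, n)` (a product of distinct primes each of which divides, by
`prime_dvd_choose_mul_choose` with `m = n − j`; the printed `n > 0` is not needed).
[cite: KrattenthalerRivoal2007, §11 Lemme 8 (arXiv:math/0311114 p. 24)] -/
theorem lemme8 (n j : ℕ) (hj : j ≤ n) : PhiKR n ∣ (n + j).choose n * (2 * n - j).choose n := by
  have h2 : 2 * n - j = n + (n - j) := by omega
  rw [h2]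
  unfold PhiKR
  apply Finset.prod_primes_dvd
  · intro p hp
    simp only [mem_filter, mem_range] at hp
    exact hp.2.1.prime
  · intro p hp
    simp only [mem_filter, mem_range] at hp
    exact prime_dvd_choose_mul_choose hp.2.1 hp.2.2 (by omega : j + (n - j) = n)

/-- The power form of Lemme 8 used for general `B` (§14, proof of Théorème 4 = (prop7gene): the summand
contains `B − 1` factors `C(n+i_k,n)C(2n−i_k,n)`, so `Φ_n^{B−1}` divides it): for indices `i_k ≤ n`, `k ∈ s`,
`Φ_n^{#s} ∣ ∏_{k∈s} C(n+i_k,n)C(2n−i_k,n)`.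
[cite: KrattenthalerRivoal2007, §14 (Démonstration du Théorème (prop7gene), «On applique donc le Lemme 8»)] -/
theorem PhiKR_pow_card_dvd_prod {ι : Type*} (s : Finset ι) (n : ℕ) (i : ι → ℕ) (hi : ∀ k ∈ s, i k ≤ n) :
    PhiKR n ^ s.card ∣ ∏ k ∈ s, ((n + i k).choose n * (2 * n - i k).choose n) := by
  have h : PhiKR n ^ s.card = ∏ _k ∈ s, PhiKR n := (Finset.prod_const _).symm
  rw [h]
  exact Finset.prod_dvd_prod_of_dvd _ _ fun k hk => lemme8 n (i k) (hi k hk)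

/-! ### §14: the binomial double sum and Lemme 15 -/

/-- The Krattenthaler–Rivoal / Zudilin double sum
`Σ_{0≤i≤j≤n} C(n,i)²C(n,j)²C(n+j,n)C(n+j−i,n)C(2n−i,n)` (a natural number; `= |u_n|` in print).
[cite: KrattenthalerRivoal2007, §14 (display before Lemme 15); Zudilin2004BinomialSums, eq. (5)] -/
def zetaFourDoubleSum (n : ℕ) : ℕ :=
  ∑ j ∈ range (n + 1), ∑ i ∈ range (j + 1),
    n.choose i ^ 2 * n.choose j ^ 2 * (n + j).choose n * (n + j - i).choose n * (2 * n - i).choose n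

/-- First values `1, 12, 804, 88680` of the double sum (`n = 0, 1, 2, 3`).
[cite: Zudilin2004BinomialSums, §1 (u₀ = 1, u₁ = 12); Zudilin2003WellPoised, §2 (5)] -/
theorem zetaFourDoubleSum_values :
    zetaFourDoubleSum 0 = 1 ∧ zetaFourDoubleSum 1 = 12 ∧ zetaFourDoubleSum 2 = 804 ∧
      zetaFourDoubleSum 3 = 88680 := by
  refine ⟨by decide, by decide, by decide, by decide⟩

/-- Krattenthaler–Rivoal's integers `C_{j,n}` of Lemme 15 without the sign `(−1)^{n+1}`:
`C(n,j)·Σ_{0≤i≤j} C(n,i)²C(2n−i,j−i)C(n+j−i,j)`. [cite: KrattenthalerRivoal2007, §14 Lemme 15 (proof)] -/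
def lemme15Coeff (n j : ℕ) : ℕ :=
  n.choose j * ∑ i ∈ range (j + 1), n.choose i ^ 2 * (2 * n - i).choose (j - i) * (n + j - i).choose j

/-- The binomial identity of the proof of Lemme 15 in additive coordinates `j = i + a`, `n = i + a + b`:
`C(n,j)C(n+j−i,n)C(2n−i,n) = C(2n−j,n)C(2n−i,j−i)C(n+j−i,j)` (both sides are
`(n+j−i)!(2n−i)!/(j!(n−j)!(j−i)!n!(n−i)!)`). [cite: KrattenthalerRivoal2007, §14 Lemme 15 (proof, display)] -/
theorem lemme15_identity_add (i a b : ℕ) :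
    (i + a + b).choose (i + a) * ((i + 2 * a + b).choose (i + a + b) * (i + 2 * a + 2 * b).choose (i + a + b)) =
      (i + a + 2 * b).choose (i + a + b) *
        ((i + 2 * a + 2 * b).choose a * (i + 2 * a + b).choose (i + a)) := by
  have hf : ∀ m : ℕ, (m ! : ℚ) ≠ 0 := fun m => by positivity
  have e1 : ((i + a + b).choose (i + a) : ℚ) = (i + a + b)! / ((i + a)! * b !) :=
    Nat.cast_add_choose ℚ
  have e2 : ((i + 2 * a + b).choose (i + a + b) : ℚ) = (i + 2 * a + b)! / ((i + a + b)! * a !) := by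
    have h := Nat.cast_add_choose ℚ (a := i + a + b) (b := a)
    rw [show i + a + b + a = i + 2 * a + b by ring] at h
    exact h
  have e3 : ((i + 2 * a + 2 * b).choose (i + a + b) : ℚ) = (i + 2 * a + 2 * b)! / ((i + a + b)! * (a + b)!) := by
    have h := Nat.cast_add_choose ℚ (a := i + a + b) (b := a + b)
    rw [show i + a + b + (a + b) = i + 2 * a + 2 * b by ring] at h
    exact h
  have e4 : ((i + a + 2 * b).choose (i + a + b) : ℚ) = (i + a + 2 * b)! / ((i + a + b)! * b !) := by
    have h := Nat.cast_add_choose ℚ (a := i + a + b) (b := b)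
    rw [show i + a + b + b = i + a + 2 * b by ring] at h
    exact h
  have e5 : ((i + 2 * a + 2 * b).choose a : ℚ) = (i + 2 * a + 2 * b)! / (a ! * (i + a + 2 * b)!) := by
    have h := Nat.cast_add_choose ℚ (a := a) (b := i + a + 2 * b)
    rw [show a + (i + a + 2 * b) = i + 2 * a + 2 * b by ring] at h
    exact h
  have e6 : ((i + 2 * a + b).choose (i + a) : ℚ) = (i + 2 * a + b)! / ((i + a)! * (a + b)!) := by
    have h := Nat.cast_add_choose ℚ (a := i + a) (b := a + b)
    rw [show i + a + (a + b) = i + 2 * a + b by ring] at h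
    exact h
  have key : ((i + a + b).choose (i + a) : ℚ) *
      (((i + 2 * a + b).choose (i + a + b) : ℚ) * ((i + 2 * a + 2 * b).choose (i + a + b) : ℚ)) =
      ((i + a + 2 * b).choose (i + a + b) : ℚ) *
        (((i + 2 * a + 2 * b).choose a : ℚ) * ((i + 2 * a + b).choose (i + a) : ℚ)) := by
    rw [e1, e2, e3, e4, e5, e6]
    field_simp
  exact_mod_cast key

/-- The identity of the proof of Lemme 15, as printed: for `0 ≤ i ≤ j ≤ n`,
`C(n,j)C(n+j−i,n)C(2n−i,n) = C(2n−j,n)C(2n−i,j−i)C(n+j−i,j)`.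
[cite: KrattenthalerRivoal2007, §14 Lemme 15 (proof, display)] -/
theorem lemme15_identity {i j n : ℕ} (hij : i ≤ j) (hjn : j ≤ n) :
    n.choose j * ((n + j - i).choose n * (2 * n - i).choose n) =
      (2 * n - j).choose n * ((2 * n - i).choose (j - i) * (n + j - i).choose j) := by
  obtain ⟨a, rfl⟩ := Nat.exists_eq_add_of_le hij
  obtain ⟨b, rfl⟩ := Nat.exists_eq_add_of_le hjn
  have h1 : i + a + b + (i + a) - i = i + 2 * a + b := by omega
  have h2 : 2 * (i + a + b) - i = i + 2 * a + 2 * b := by omega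
  have h3 : 2 * (i + a + b) - (i + a) = i + a + 2 * b := by omega
  have h4 : i + a - i = a := by omega
  rw [h1, h2, h3, h4]
  exact lemme15_identity_add i a b

/-- **Lemme 15** (regrouping): `Σ_{i≤j} C(n,i)²C(n,j)²C(n+j,n)C(n+j−i,n)C(2n−i,n) = Σ_j C(n+j,n)C(2n−j,n)·C_{j,n}`
with the natural numbers `C_{j,n} = lemme15Coeff n j`. [cite: KrattenthalerRivoal2007, §14 Lemme 15] -/
theorem zetaFourDoubleSum_eq_sum_lemme15 (n : ℕ) :
    zetaFourDoubleSum n =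
      ∑ j ∈ range (n + 1), (n + j).choose n * (2 * n - j).choose n * lemme15Coeff n j := by
  unfold zetaFourDoubleSum lemme15Coeff
  refine sum_congr rfl fun j hj => ?_
  rw [mem_range] at hj
  simp_rw [Finset.mul_sum]
  refine sum_congr rfl fun i hi => ?_
  rw [mem_range] at hi
  have hid := lemme15_identity (by omega : i ≤ j) (by omega : j ≤ n)
  calc n.choose i ^ 2 * n.choose j ^ 2 * (n + j).choose n * (n + j - i).choose n * (2 * n - i).choose n
      = n.choose i ^ 2 * n.choose j * (n + j).choose n *
          (n.choose j * ((n + j - i).choose n * (2 * n - i).choose n)) := by ring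
    _ = n.choose i ^ 2 * n.choose j * (n + j).choose n *
          ((2 * n - j).choose n * ((2 * n - i).choose (j - i) * (n + j - i).choose j)) := by rw [hid]
    _ = (n + j).choose n * (2 * n - j).choose n *
          (n.choose j * (n.choose i ^ 2 * (2 * n - i).choose (j - i) * (n + j - i).choose j)) := by ring

/-- **`Φ_n` divides the double sum** — Théorème 3 (i) of Krattenthaler–Rivoal for the binomial form of the
`ζ(4)` leading coefficient: Lemme 15 exhibits the factor `C(n+j,n)C(2n−j,n)` in every term and Lemme 8 applies.
[cite: KrattenthalerRivoal2007, §14 (Démonstration du Théorème 3, partie i)] -/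
theorem PhiKR_dvd_zetaFourDoubleSum (n : ℕ) : PhiKR n ∣ zetaFourDoubleSum n := by
  rw [zetaFourDoubleSum_eq_sum_lemme15]
  refine Finset.dvd_sum fun j hj => ?_
  rw [mem_range] at hj
  exact Dvd.dvd.mul_right (lemme8 n j (by omega)) _

/-! ### The identification with Zudilin's recurrence sequence `u_n` (named fact) and Théorème 3 (i) -/

/-- Transcription check of the named fact below on `n ≤ 3`: the tree's recurrence-defined `u_n`
(`ZetaFour.u`, `u₀ = 1`, `u₁ = 12`, [Zudilin2003WellPoised, §2 (3)–(5)]) agrees with the double sum: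
`u₂ = 804`, `u₃ = 88680`. [cite: Zudilin2004BinomialSums, §1 (recursion, u₀ = 1, u₁ = 12, «u_n = Σ_{i,j} …»)] -/
theorem u_eq_zetaFourDoubleSum_le_three :
    ∀ n ≤ 3, Zudilin2003.ZetaFour.u n = (zetaFourDoubleSum n : ℚ) := by
  intro n hn
  interval_cases n
  · simp [zetaFourDoubleSum_values.1, Zudilin2003.ZetaFour.u, Zudilin2003.ZetaFour.seq]
  · simp [zetaFourDoubleSum_values.2.1, Zudilin2003.ZetaFour.u, Zudilin2003.ZetaFour.seq]
  · rw [zetaFourDoubleSum_values.2.2.1, Zudilin2003.ZetaFour.u_two]; norm_num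
  · rw [zetaFourDoubleSum_values.2.2.2]
    norm_num [Zudilin2003.ZetaFour.u, Zudilin2003.ZetaFour.seq, Zudilin2003.ZetaFour.b,
      Zudilin2003.ZetaFour.c]

/-- **Zudilin's `ζ(4)` denominators are the binomial double sum** (named fact, statement only; a THEOREM in
print): the solution `u_n` of `(n+1)⁵u_{n+1} − 3(2n+1)(3n²+3n+1)(15n²+15n+4)u_n − 3n³(3n−1)(3n+1)u_{n−1} = 0`,
`u₀ = 1`, `u₁ = 12` (tree: `Zudilin2003.ZetaFour.u`) satisfies
`u_n = Σ_{i,j} C(n,i)²C(n,j)²C(n+j,n)C(n+j−i,n)C(2n−i,n)` for every `n ≥ 0`. Printed proofs: Krattenthaler–Rivoal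
(Proposition (cor:A4) with `A = 4, B = 2`, hyperharmonic/hypergeometric multisum identities) and Zudilin 2004
(Andrews's multisum generalisation of Whipple's `₇F₆` transformation, `ε → 0`); neither tool is in the tree, hence a
named fact. Checked in the kernel for `n ≤ 3` (`u_eq_zetaFourDoubleSum_le_three`).
[cite: Zudilin2004BinomialSums, eq. (5) and the display after (1) («u_n = Σ_{i,j} …, n = 0,1,2,…»);
KrattenthalerRivoal2007, §14 (display before Lemme 15)] -/
def u_eq_zetaFourDoubleSum : Prop :=
  ∀ n : ℕ, Zudilin2003.ZetaFour.u n = (zetaFourDoubleSum n : ℚ)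

/-- `u_n ∈ ℤ` («from which one has the desired inclusions u_n ∈ ℤ», conjectured in Zudilin 2003), from the
double-sum representation. [cite: Zudilin2004BinomialSums, §1; KrattenthalerRivoal2007, §14] -/
theorem u_isInt_of (h : u_eq_zetaFourDoubleSum) (n : ℕ) : ∃ z : ℤ, Zudilin2003.ZetaFour.u n = z :=
  ⟨zetaFourDoubleSum n, by rw [h n]; norm_cast⟩

/-- **Théorème 3 (i)** (Krattenthaler–Rivoal): `Φ_n⁻¹ u_n` is an integer, `Φ_n = ∏_{p prime, {n/p} ∈ [2/3,1)} p`
(`PhiKR`) — from the double-sum representation (named fact `u_eq_zetaFourDoubleSum`) and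
`PhiKR_dvd_zetaFourDoubleSum` (Lemme 15 + Lemme 8), exactly as in the printed proof.
[cite: KrattenthalerRivoal2007, §3 Théorème 3 (i) and §14] -/
theorem theoreme3_i (h : u_eq_zetaFourDoubleSum) (n : ℕ) :
    ∃ z : ℤ, Zudilin2003.ZetaFour.u n = (PhiKR n : ℚ) * z := by
  obtain ⟨k, hk⟩ := PhiKR_dvd_zetaFourDoubleSum n
  refine ⟨k, ?_⟩
  rw [h n, hk]
  push_cast
  ring

end Literature.NumberTheory.Irrationality.KrattenthalerRivoal2007
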